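import Summits.Ventures.PercRepro.Night2NonFatLevels

/-!
# night-2: the NON-FAT case of (FAIR) — the face sum as a sum over HYPERPLANES (gen 37)

`faceSum T = Σ_{B thin four-point member ⊆ T} phiFace B · |(T ∖ K) ∖ cl B|`, and both factors depend on `B` only through its
closure `H = cl B` (a hyperplane of `G` through `K`): `phiFace B = max 0 (Φ / |gr ∖ H| − 11/90)`.  So the face sum is a sum over the
hyperplanes spanned by the member faces inside `T`, each weighted by `hypWeight T H = phi H · |(T ∖ K) ∖ H|` times the number of member
faces spanning it (`faceSum_eq_sum_hyperplanes`, by `Finset.sum_comp`); that number is at most `C(|(T ∖ K) ∩ H|, 4)` (the faces are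
four-point subsets of `(T ∖ K) ∩ H`, `card_facesIn_fiber_le_choose`); and the weight vanishes as soon as `H` misses eight points of `G`
(`hypWeight_eq_zero_of_eight_le`: `Φ/(8 + 2) = 7/60 < 11/90`), is at most `(1/9) · |(T ∖ K) ∖ H|` when `H` misses three (no fat closure:
`hypWeight_le_of_three_le`).  Hence **`faceSum_le_sum_big_hyperplanes`**: the face sum of a target is bounded by the BIG hyperplanes
(`|G ∖ H| ≤ 7`) spanned by its faces, `Σ_H phi H · |(T ∖ K) ∖ H| · C(|(T ∖ K) ∩ H|, 4)` — the accounting every further regime of the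
non-fat case needs (paper g37 §6: at `N = 5` the faces inside the two basis hyperplanes containing `Y` carry the face sum).
Paper: proofs/NIGHT-2-g37.md §6.
-/

namespace PercRepro.Shadow

open PercRepro.ThmH PercRepro.PerFlat

variable {α : Type*} [DecidableEq α] {M : Matroid α} [M.Finite] {G : Finset α}

open scoped Classical in
/-- The thin four-point members inside a target `T`. -/
noncomputable def facesIn (M : Matroid α) [M.Finite] (G T : Finset α) : Finset (Finset α) :=
  (thinMembers M 5 G).filter (fun B => ¬ bigP M G B ∧ B ⊆ T)

/-- The weight of a hyperplane `H` at the target `T`: `phi H · |(T ∖ K) ∖ H|`, `phi H = max 0 (Φ / |gr ∖ H| − 11/90)`. -/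
noncomputable def hypWeight (M : Matroid α) [M.Finite] (G T H : Finset α) : ℚ :=
  max 0 (phiQ 5 / ((gr M \ H).card : ℚ) - 11 / 90) * (((T \ coloops M G) \ H).card : ℚ)

/-- `phiFace` depends on the member only through its closure. -/
theorem phiFace_eq_of_clF (B : Finset α) : phiFace M B = max 0 (phiQ 5 / ((gr M \ clF M B).card : ℚ) - 11 / 90) := by
  unfold phiFace req
  rfl

/-- The face sum is the sum of the hyperplane weights over the member faces inside `T`. -/
theorem faceSum_eq_sum_facesIn (T : Finset α) :
    faceSum M G T = ∑ B ∈ facesIn M G T, hypWeight M G T (clF M B) := by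
  unfold faceSum facesIn hypWeight
  apply Finset.sum_congr rfl
  intro B _
  rw [phiFace_eq_of_clF]

open scoped Classical in
/-- **The face sum as a sum over hyperplanes**: `Σ_{H} hypWeight T H · #{faces inside T spanning H}`. -/
theorem faceSum_eq_sum_hyperplanes (T : Finset α) :
    faceSum M G T = ∑ H ∈ (facesIn M G T).image (clF M),
      hypWeight M G T H * (((facesIn M G T).filter (fun B => clF M B = H)).card : ℚ) := by
  rw [faceSum_eq_sum_facesIn, Finset.sum_comp (hypWeight M G T) (clF M)]
  apply Finset.sum_congr rfl
  intro H _
  rw [nsmul_eq_mul, mul_comm]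

/-- A member face inside `T` is determined by its four points in `(T ∖ K) ∩ cl B`. -/
theorem card_facesIn_fiber_le_choose (hG : G ∈ flatsQ M (5 + 1)) (hd : (gr M \ G).card = 2)
    (hk : kColoops M G = 1) (T H : Finset α) :
    ((facesIn M G T).filter (fun B => clF M B = H)).card ≤ (((T \ coloops M G) ∩ H).card).choose 4 := by
  have hd' : (gr M \ G).card ≤ 5 := by omega
  rw [← Finset.card_powersetCard]
  apply Finset.card_le_card_of_injOn (fun B => B \ coloops M G)
  · intro B hB
    rw [Finset.mem_coe, Finset.mem_filter] at hB
    obtain ⟨hBin, hBH⟩ := hB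
    unfold facesIn at hBin
    rw [Finset.mem_filter] at hBin
    obtain ⟨hBthin, hnP, hBT⟩ := hBin
    rw [Finset.mem_coe, Finset.mem_powersetCard]
    refine ⟨?_, card_sdiff_eq_four_of_not_bigP hG hd hk hBthin hnP⟩
    intro e he
    rw [Finset.mem_sdiff] at he
    rw [Finset.mem_inter, Finset.mem_sdiff]
    refine ⟨⟨hBT he.1, he.2⟩, ?_⟩
    rw [← hBH]
    exact subset_clF_of_subset_gr ((subset_G_of_mem_thinMembers hBthin).trans (mem_flatsQ.1 hG).1) he.1
  · intro B₁ hB₁ B₂ hB₂ heq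
    rw [Finset.mem_coe, Finset.mem_filter] at hB₁ hB₂
    have hK₁ : coloops M G ⊆ B₁ := by
      unfold facesIn at hB₁
      exact coloops_subset_of_mem_thinMembers hG hd' (Finset.mem_filter.1 hB₁.1).1
    have hK₂ : coloops M G ⊆ B₂ := by
      unfold facesIn at hB₂
      exact coloops_subset_of_mem_thinMembers hG hd' (Finset.mem_filter.1 hB₂.1).1
    simp only at heq
    rw [← Finset.sdiff_union_of_subset hK₁, ← Finset.sdiff_union_of_subset hK₂, heq]

/-- The hyperplane weight is nonnegative. -/
theorem hypWeight_nonneg (T H : Finset α) : 0 ≤ hypWeight M G T H := by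
  unfold hypWeight
  apply mul_nonneg (le_max_left _ _) (by positivity)

/-- For `H ⊆ G`: `|gr ∖ H| = |G ∖ H| + |gr ∖ G|`. -/
theorem card_sdiff_gr_eq (hG : G ∈ flatsQ M (5 + 1)) {H : Finset α} (hHG : H ⊆ G) :
    (gr M \ H).card = (G \ H).card + (gr M \ G).card := by
  have hGg : G ⊆ gr M := (mem_flatsQ.1 hG).1
  rw [← Finset.card_union_of_disjoint]
  · congr 1
    ext e
    simp only [Finset.mem_sdiff, Finset.mem_union]
    constructor
    · rintro ⟨heg, heH⟩
      by_cases heG : e ∈ G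
      · exact Or.inl ⟨heG, heH⟩
      · exact Or.inr ⟨heg, heG⟩
    · rintro (⟨heG, heH⟩ | ⟨heg, heG⟩)
      · exact ⟨hGg heG, heH⟩
      · exact ⟨heg, fun heH => heG (hHG heH)⟩
  · rw [Finset.disjoint_left]
    intro e he1 he2
    exact (Finset.mem_sdiff.1 he2).2 (Finset.mem_sdiff.1 he1).1

/-- **A hyperplane missing eight points of `G` has weight zero**: `Φ / (8 + 2) = 7/60 < 11/90`. -/
theorem hypWeight_eq_zero_of_eight_le (hG : G ∈ flatsQ M (5 + 1)) (hd : (gr M \ G).card = 2) (T : Finset α)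
    {H : Finset α} (hHG : H ⊆ G) (h8 : 8 ≤ (G \ H).card) : hypWeight M G T H = 0 := by
  unfold hypWeight
  rw [card_sdiff_gr_eq hG hHG, hd]
  push_cast
  have h8' : (8 : ℚ) ≤ ((G \ H).card : ℚ) := by exact_mod_cast h8
  have hle : phiQ 5 / (((G \ H).card : ℚ) + 2) - 11 / 90 ≤ 0 := by
    unfold phiQ
    rw [sub_nonpos, div_le_iff₀ (by linarith)]
    linarith
  rw [max_eq_left hle, zero_mul]

/-- **A hyperplane missing three points of `G` has weight at most `(1/9) · |(T ∖ K) ∖ H|`.** -/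
theorem hypWeight_le_of_three_le (hG : G ∈ flatsQ M (5 + 1)) (hd : (gr M \ G).card = 2) (T : Finset α)
    {H : Finset α} (hHG : H ⊆ G) (h3 : 3 ≤ (G \ H).card) :
    hypWeight M G T H ≤ 1 / 9 * (((T \ coloops M G) \ H).card : ℚ) := by
  unfold hypWeight
  rw [card_sdiff_gr_eq hG hHG, hd]
  apply mul_le_mul_of_nonneg_right _ (by positivity)
  have h3' : (3 : ℚ) ≤ ((G \ H).card : ℚ) := by exact_mod_cast h3
  apply max_le (by norm_num)
  unfold phiQ
  push_cast
  rw [sub_le_iff_le_add, div_le_iff₀ (by linarith)]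
  linarith

/-- The closure of a member face inside `T` lies in `G`. -/
theorem clF_subset_G_of_mem_facesIn {T B : Finset α} (hB : B ∈ facesIn M G T) : clF M B ⊆ G := by
  unfold facesIn at hB
  rw [Finset.mem_filter] at hB
  exact (mem_membersIn.1 (mem_thinMembers.1 hB.1).1).2

open scoped Classical in
/-- **The face sum is bounded by the BIG hyperplanes spanned by the faces inside `T`** (those missing at most seven points of
`G`), each counted with weight `hypWeight T H` and multiplicity `C(|(T ∖ K) ∩ H|, 4)`. -/
theorem faceSum_le_sum_big_hyperplanes (hG : G ∈ flatsQ M (5 + 1)) (hd : (gr M \ G).card = 2)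
    (hk : kColoops M G = 1) (T : Finset α) :
    faceSum M G T ≤ ∑ H ∈ ((facesIn M G T).image (clF M)).filter (fun H => (G \ H).card ≤ 7),
      hypWeight M G T H * (((((T \ coloops M G) ∩ H).card).choose 4 : ℕ) : ℚ) := by
  rw [faceSum_eq_sum_hyperplanes]
  have hsplit : ∑ H ∈ (facesIn M G T).image (clF M),
      hypWeight M G T H * (((facesIn M G T).filter (fun B => clF M B = H)).card : ℚ) =
      ∑ H ∈ ((facesIn M G T).image (clF M)).filter (fun H => (G \ H).card ≤ 7),
      hypWeight M G T H * (((facesIn M G T).filter (fun B => clF M B = H)).card : ℚ) := by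
    symm
    apply Finset.sum_filter_of_ne
    intro H hH hne
    by_contra h7
    rw [not_le] at h7
    obtain ⟨B, hB, rfl⟩ := Finset.mem_image.1 hH
    rw [hypWeight_eq_zero_of_eight_le hG hd T (clF_subset_G_of_mem_facesIn hB) (by omega), zero_mul] at hne
    exact hne rfl
  rw [hsplit]
  apply Finset.sum_le_sum
  intro H _
  apply mul_le_mul_of_nonneg_left _ (hypWeight_nonneg T H)
  exact_mod_cast card_facesIn_fiber_le_choose hG hd hk T H

end PercRepro.Shadow
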